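import Summits.ResolutionOfSingularities.ResolutionOfSingularities.Theorems.FrobeniusClosingPatchingRelPerfectDepthFlagLegalPhaseTwo
import Summits.ResolutionOfSingularities.ResolutionOfSingularities.Theorems.FrobeniusClosingPatchingRelPerfectDepthFlagLegalPhases
import HarnessLib

/-!
# Chain W5.2 — F6 stage 1, residual `LegalScopedDivisorReduction₃`: PHASE 2 `LegalPhaseTwo₃` CLOSED BY NAME modulo the
# F-60♯-shaped OURS binder `OldBoundaryResolution₃`

[OURS · L1 W5.2 · res-D-pv-016 AS res-L1-w52-stub-5, LDR₃ hand #1 = closer (2a) (res-L1-w52-idea-1 OWNER RULING O1.3/O2.3; targets of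
record `…DepthFlagLegalPhases`, Φ rev 3).]  NOT statements of the manuscript under review; AI-written, weaker than expert review.
Fact-free kernel work; the ONLY non-kernel input is the explicit hypothesis `(hOB : DepthLegal.OldBoundaryResolution₃)`
(`…DepthFlagLegalOldBoundary`, OURS CONDITIONAL binder — res-dag-4 FACT RULING 2026-08-27T12:01:38Z (3); to be discharged as a kernel
corollary of the reserved construction-fact F-72).

`legalPhaseTwo₃_of_oldBoundary : OldBoundaryResolution₃ → LegalPhaseTwo₃` — unpack `FlagState₃ E H H` and `HostBoundary₃ E H`
(= `∃ D ℬ, WeightTwoB.StateIn H D ℬ [] ∧ Scheme.IsRegular D.subscheme`), apply the content theorem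
`DepthLegal.phaseTwo_sncSupport_of_stateIn` (`…DepthFlagLegalPhaseTwo`, p532072: weight-two transport along an
old-boundary-permissible sequence, legality L2 by order), repack `FlagState₃ E' H' H'` (diagonal, `le_rfl`) and `SncSupport`.
With Γ's `legalScopedDivisorReduction₃_of_phaseOne_of_phaseTwo` the residual is then `⟨LegalPhaseOne₃, OldBoundaryResolution₃⟩`.
[cite: CossartJannsenSaito2020, Thm. 1.4, Cor. 6.26, Def. 6.23 (2)] [cite: Kollar2007, 3.30.2]
-/

-- `Summit.<Summit>.<Sub>.Theorems` with `Sub = Summit` (single-conjunct summit, D-0017)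
set_option linter.dupNamespace false

noncomputable section

open CategoryTheory CategoryTheory.Limits AlgebraicGeometry TopologicalSpace
open Literature.AlgebraicGeometry.Resolution

namespace Summit.ResolutionOfSingularities.ResolutionOfSingularities.Theorems.DepthTargets

universe u

/-- [OURS · L1 W5.2] **`LegalPhaseTwo₃` modulo `OldBoundaryResolution₃`** — PHASE 2 of the residual `LegalScopedDivisorReduction₃`
(«make the support snc, legally») holds as soon as the F-60♯-shaped OURS binder does: by res-D-pv-016's weight-two transport
`DepthLegal.phaseTwo_sncSupport_of_stateIn`. CONDITIONAL (one OURS binder, named); fact-free otherwise.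
[cite: CossartJannsenSaito2020, Thm. 1.4, Cor. 6.26, Def. 6.23 (2)] [cite: Kollar2007, 3.30.2] -/
theorem legalPhaseTwo₃_of_oldBoundary (hOB : DepthLegal.OldBoundaryResolution₃.{u}) : LegalPhaseTwo₃.{u} := by
  intro E _ H hfs hhb
  obtain ⟨hint, hnoeth, hreg, hexc, hdim, hne, hlp, -⟩ := hfs
  haveI := hint
  obtain ⟨D, ℬ, S, hDreg⟩ := hhb
  obtain ⟨E', π, H', hseq, hint', hnoeth', hreg', hexc', hdim', hne', hlp', hsnc⟩ :=
    DepthLegal.phaseTwo_sncSupport_of_stateIn hOB hreg hexc hdim hne hlp S hDreg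
  exact ⟨E', π, H', hseq, ⟨hint', hnoeth', hreg', hexc', hdim', hne', hlp', le_rfl⟩, hsnc⟩

end Summit.ResolutionOfSingularities.ResolutionOfSingularities.Theorems.DepthTargets

end
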